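/-
Copyright: cell pub-balaban-gaps, seat ne8 (estimate NE7c), gen 14. Project licence.
-/
import Summits.QuantumFields.BalabanUV.T4Continuum.Spine.NE7c.LiveFactorWindowDoubling
import Summits.QuantumFields.BalabanUV.T4Continuum.Spine.NE7c.LiveFactorWindowLaplace

/-!
# Road (δ) on the WINDOWED BOLTZMANN WEIGHT: the restricted one-plaquette partition function
# `z_β(t) = ∫_{Re tr(1−V) ≤ t} e^{−β·Re tr(1−V)} dHaar` doubles like the bare window — `(√ν)^{d(𝔤)}·z_β(t) ≤ D·z_β(νt)` for ALL `β ≥ 0`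
# (`SU(2)`: `D = 1`) —, so print's INTEGRATED ∕ profile currency ((0.15), (1.2) ⟹ (1.10)) at a live window loses exactly like the volume
# currency, `½d(𝔤)·log ν₀⁻¹` per plaquette variable, β-UNIFORMLY and with NO nesting clause (row NE7c; junction J-17)

Cell `pub-balaban-gaps` (G2), seat ne8, estimate **NE7c** (`T4IndicatorShell.ShellWeightBound`; two-run artefact, NOT PRINTED in
[Bałaban 1983–89], NOT PROVED).  Proof-only file under `Spine/NE7c/`: imports this seat's file 30 `LiveFactorWindowDoubling` (hence ne6's V38
`CompactFibreHalvedActionSUN` — window doubling on `SU(N)`, its generic layer cake — and V40c `CompactFibreWindowSU2DoublingHaar`, `D = 1` on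
`SU(2)`) and file 33 `LiveFactorWindowLaplace` (the product-window Fubini `setIntegral_pi_window_eq_pow`, BY NAME).  Nothing of Bałaban's is named; no `def`; 0 `sorry`.

THE QUESTION (seat census `HOME/ne/NE7c.md` §21, row 48 (iv)).  The (n)-carrier's creation step divides by a RESTRICTED partition function — a
window volume weighted by a Boltzmann ∕ Gaussian profile: print's `z = ∫_{|u−1|<ε₀} exp[−(1∕α)(1 − Re tr u)] du` ([Balaban1987RG1] (0.15)), the
denominator of [Balaban1989LargeFieldII] (1.2), ne6's profile letter (V27 ∕ V35).  File 27 §4 read V27's bound at a live OUTER window and found it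
FREE below the nesting clause `σ ≤ ν₀η` (the inner Gaussian window carries the bound).  File 30 read the BARE window volume: live = unlowered ×
`ν^{½d(𝔤)}`.  What does the live factor cost on the WEIGHTED window, for an arbitrary inverse coupling `β ≥ 0` and with no clause at all?

ANSWER ([folklore]; V38's doubling and layer cake BY NAME, one change of variables): the same `ν^{½d(𝔤)}`, β-uniformly.
* §0 `setIntegral_exp_neg_mul_le_of_sublevel` — V38's generic layer cake (`integral_exp_neg_mul_le_of_sublevel`) for RESTRICTED integrals: on a
  finite measure space, if `μ({a·s ≤ L} ∩ A) ≤ K·μ({b·s ≤ L} ∩ B)` for every real `L` (`s ≥ 0` measurable, `b ≥ 0`, `K ≥ 0`, any sets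
  `A, B`), then `∫_A e^{−a·s} dμ ≤ K·∫_B e^{−b·s} dμ`.
* §1 ABSTRACT: `setIntegral_window_live_ge` — for a deficit `s ≥ 0` whose window function `u ↦ μ{s ≤ u}` doubles with exponent `k` and constant
  `D` (`μ{s ≤ λ²u} ≤ D·λᵏ·μ{s ≤ u}`, `λ ≥ 1`): `(√ν)ᵏ·∫_{s ≤ t} e^{−βs} dμ ≤ D·∫_{s ≤ νt} e^{−βs} dμ` for ALL `β ≥ 0`, `0 < ν ≤ 1`, real `t`
  (the sublevel sets `{s ≤ t} ∩ {βν·s ≤ L}` and `{s ≤ νt} ∩ {β·s ≤ L}` are the windows at `min(t, L∕βν)` and `ν·min(t, L∕βν)`; file 30's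
  `live_lower_of_doubling` compares them; §0 turns that into `∫_{s≤t} e^{−βν s} ≤ D(√ν)^{−k}∫_{s≤νt} e^{−βs}`, and `e^{−βs} ≤ e^{−βνs}`).
* §2 `SU(N)`, ALL `N` (V38's constant): `exists_windowedBoltzmann_live_ge`; `SU(2)` SHARP (V40c): **`windowedBoltzmann_live_ge_sharp`**
  (`(√ν)³·z_β(t) ≤ z_β(νt)`, all `β ≥ 0`, all `t`), `windowedBoltzmann_ge` (`z_β(t) ≥ e^{−βt}·Haar(W_t)`, hence `> 0` at a window of positive volume),
  `neg_log_windowedBoltzmann_live_le_sharp` (`−log z_β(νt) ≤ −log z_β(t) + (3∕2)·log ν⁻¹`), **`letter_windowedBoltzmann_live_sharp`** (ANY letter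
  `−log z_β(t) ≤ L` ⟹ `−log z_β(νt) ≤ L + (3∕2)·log ν₀⁻¹` for every `ν ∈ [ν₀, 1]` — β-uniform, clause-free).
* §3 THE REGION (product Haar on `B → SU(2)`, `S = Σ_b Re tr(1 − v_b)`, window `Π_b W`; Fubini = file 33's `setIntegral_pi_window_eq_pow`
  BY NAME): **`windowedBoltzmann_pi_live_ge_sharp`** (`(√ν)^{3·#B}·∫_{Π W_t} e^{−βS} dκ ≤ ∫_{Π W_{νt}} e^{−βS} dκ`),
  **`neg_log_windowedBoltzmann_pi_live_le_sharp`** (`−log ∫_{Π W_{νt}} e^{−βS} ≤ −log ∫_{Π W_t} e^{−βS} + #B·(3∕2)·log ν₀⁻¹`).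
* §4 sanity: at `β = 0` §2 is file 30's bare window doubling.

CENSUS (row 48 (iv), NEW; `HOME/ne/NE7c.md` §21.1): the INTEGRATED ∕ profile currency of the creation step's denominator — print's own ((0.15)'s `z`,
(1.2) ⟹ (1.10)) — is priced at a live window EXACTLY like the volume currency: `½d(𝔤)·log ν₀⁻¹` per plaquette variable RELATIVE to the unlowered
letter, for EVERY inverse coupling `β ≥ 0`, with NO nesting clause and no inner window (row 47 (ii)'s «FREE below `σ ≤ ν₀η`» is the regime in which
the Gaussian width sits inside the lowered window; this row is the β-uniform worst case).  MILD; identical under every member of road (δ).  BY-NAME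
EFFECT ON THE WALL: none (junction ∕ census file).

NOT HERE (honest): general antitone profiles `w(s)` (the same layer cake; only `e^{−βs}` is typed), the operator-norm window of (0.15) (the tree's
`B16ZLower` — its `ε₀` is the FIXED regular-space constant, not a randomised threshold: no live reading needed), `SU(3)`'s sharp constant; which
`t(g_k)`, `β = g_k⁻²` Bałaban's step carries and that its creation-level carrier IS the (n)-carrier — ne6's (A3) ∕ (A1c) list applies verbatim
(NC-NE7b-α UNRULED); node O; NE7c.  VERDICT WORD UNCHANGED: WORK-bound behind node O; INSTANCE 0∕1.  NE7c ∕ NE7b NOT PRINTED ∕ NOT PROVED;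
spine 0∕9; one finite T⁴ — NOT ℝ⁴, NOT infinite volume, NOT the mass gap, NOT Clay.
HONEST DEPENDENCY (cell): continuum YM on T⁴ ⇐ BetaPertH ∧ nine spine estimates (0∕9 proved); BetaPertH ⇐ (D1) ∧ (D4) ∧ CAP+tail.
-/

set_option autoImplicit false

noncomputable section

open MeasureTheory Real Finset Set
open scoped Matrix.Norms.Frobenius ENNReal
open Literature.MathematicalPhysics.QuantumFieldTheory (haarProbability)
open Literature.MathematicalPhysics.QuantumFieldTheory.UnitaryCayley (re_trace_one_sub)
open Summit.QuantumFields.BalabanUV.T4Continuum.NE7b.CompactFibreHalvedActionSUN (measurable_re_trace_one_sub measurableSet_traceWindow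
  exists_haarReal_traceWindow_doubling)
open Summit.QuantumFields.BalabanUV.T4Continuum.NE7b.CompactFibreWindowSU2DoublingHaar (haarReal_traceWindow_doubling_one)
open Summit.QuantumFields.BalabanUV.T4Continuum.Spine.NE7c.LiveFactorWindowDoubling (live_lower_of_doubling half_mul_log_inv_le)
open Summit.QuantumFields.BalabanUV.T4Continuum.Spine.NE7c.LiveFactorWindowLaplace (setIntegral_pi_window_eq_pow)

namespace Summit.QuantumFields.BalabanUV.T4Continuum.Spine.NE7c.LiveFactorWindowBoltzmann

/-! ## §0 V38's generic layer cake for RESTRICTED integrals -/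

section LayerCake

variable {X : Type*} [MeasurableSpace X] (μ : Measure X) [IsFiniteMeasure μ]

/-- **RESTRICTED LAYER CAKE.**  On a finite measure space, `s ≥ 0` measurable, `b ≥ 0`, `K ≥ 0`, `A, B` any sets: if
`μ({a·s ≤ L} ∩ A) ≤ K·μ({b·s ≤ L} ∩ B)` for all real `L`, then `∫_A e^{−a·s} dμ ≤ K·∫_B e^{−b·s} dμ` (V38's
`integral_exp_neg_mul_le_of_sublevel` run on `μ|_A`, `μ|_B`). [folklore] -/
theorem setIntegral_exp_neg_mul_le_of_sublevel {s : X → ℝ} (hs : Measurable s) (hs0 : ∀ x, 0 ≤ s x) {a b K : ℝ} (hb : 0 ≤ b)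
    (hK : 0 ≤ K) {A B : Set X}
    (h : ∀ L : ℝ, μ.real ({x | a * s x ≤ L} ∩ A) ≤ K * μ.real ({x | b * s x ≤ L} ∩ B)) :
    ∫ x in A, Real.exp (-(a * s x)) ∂μ ≤ K * ∫ x in B, Real.exp (-(b * s x)) ∂μ := by
  have hmeas : ∀ c : ℝ, Measurable fun x => Real.exp (-(c * s x)) := fun c => (Real.measurable_exp.comp ((hs.const_mul c).neg))
  have hle1 : ∀ c : ℝ, 0 ≤ c → ∀ x, Real.exp (-(c * s x)) ≤ 1 := fun c hc x => by
    rw [Real.exp_le_one_iff]; nlinarith [hs0 x]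
  have hint : Integrable (fun x => Real.exp (-(b * s x))) (μ.restrict B) :=
    Integrable.of_bound (hmeas b).aestronglyMeasurable 1 (ae_of_all _ fun x => by
      rw [Real.norm_eq_abs, abs_of_pos (Real.exp_pos _)]; exact hle1 b hb x)
  have hmsl : ∀ c L, MeasurableSet {x | c * s x ≤ L} := fun c L => measurableSet_le (hs.const_mul c) measurable_const
  -- the sublevel domination in `ℝ≥0∞` for the restricted measures
  have hsub : ∀ L : ℝ, (μ.restrict A) {x | a * s x ≤ L} ≤ ENNReal.ofReal K * (μ.restrict B) {x | b * s x ≤ L} := fun L => by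
    rw [Measure.restrict_apply (hmsl a L), Measure.restrict_apply (hmsl b L)]
    have h1 := h L
    rw [measureReal_def, measureReal_def] at h1
    calc μ ({x | a * s x ≤ L} ∩ A) = ENNReal.ofReal ((μ ({x | a * s x ≤ L} ∩ A)).toReal) :=
          (ENNReal.ofReal_toReal (measure_ne_top _ _)).symm
      _ ≤ ENNReal.ofReal (K * (μ ({x | b * s x ≤ L} ∩ B)).toReal) := ENNReal.ofReal_le_ofReal h1
      _ = ENNReal.ofReal K * μ ({x | b * s x ≤ L} ∩ B) := by
          rw [ENNReal.ofReal_mul hK, ENNReal.ofReal_toReal (measure_ne_top _ _)]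
  have hcakeA := lintegral_eq_lintegral_meas_le (μ.restrict A) (ae_of_all _ fun x => (Real.exp_pos (-(a * s x))).le)
    (hmeas a).aemeasurable
  have hcakeB := lintegral_eq_lintegral_meas_le (μ.restrict B) (ae_of_all _ fun x => (Real.exp_pos (-(b * s x))).le)
    (hmeas b).aemeasurable
  have hsets : ∀ c : ℝ, ∀ t : ℝ, 0 < t → {x | t ≤ Real.exp (-(c * s x))} = {x | c * s x ≤ -Real.log t} := fun c t ht => by
    ext x
    simp only [Set.mem_setOf_eq]
    rw [← Real.log_le_iff_le_exp ht]
    constructor <;> intro hx <;> linarith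
  have hlin : ∫⁻ x, ENNReal.ofReal (Real.exp (-(a * s x))) ∂(μ.restrict A)
      ≤ ENNReal.ofReal K * ∫⁻ x, ENNReal.ofReal (Real.exp (-(b * s x))) ∂(μ.restrict B) := by
    rw [hcakeA, hcakeB, ← lintegral_const_mul' _ _ ENNReal.ofReal_ne_top]
    refine setLIntegral_mono' measurableSet_Ioi fun t ht => ?_
    rw [hsets a t ht, hsets b t ht]
    exact hsub _
  have hfinB : ∫⁻ x, ENNReal.ofReal (Real.exp (-(b * s x))) ∂(μ.restrict B) ≠ ∞ := hint.lintegral_lt_top.ne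
  rw [integral_eq_lintegral_of_nonneg_ae (ae_of_all _ fun x => (Real.exp_pos _).le) (hmeas a).aestronglyMeasurable,
    integral_eq_lintegral_of_nonneg_ae (ae_of_all _ fun x => (Real.exp_pos _).le) (hmeas b).aestronglyMeasurable,
    ← ENNReal.toReal_ofReal hK, ← ENNReal.toReal_mul]
  exact ENNReal.toReal_mono (ENNReal.mul_ne_top ENNReal.ofReal_ne_top hfinB) hlin

/-! ## §1 Abstract: a doubling window function carries the windowed Boltzmann weight, β-uniformly -/

/-- **THE WINDOWED BOLTZMANN WEIGHT AT A LIVE WINDOW** (abstract).  Let `s ≥ 0` be a measurable deficit on a finite measure space whose window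
function doubles with exponent `k` and constant `D ≥ 0`: `μ{s ≤ λ²u} ≤ D·λᵏ·μ{s ≤ u}` for all `λ ≥ 1`, all real `u`.  Then for EVERY `β ≥ 0`,
every live factor `0 < ν ≤ 1` and every level `t`: `(√ν)ᵏ·∫_{s ≤ t} e^{−β·s} dμ ≤ D·∫_{s ≤ ν·t} e^{−β·s} dμ`. [folklore] -/
theorem setIntegral_window_live_ge {s : X → ℝ} (hs : Measurable s) (hs0 : ∀ x, 0 ≤ s x) {D : ℝ} {k : ℕ} (hD : 0 ≤ D)
    (hdoub : ∀ l : ℝ, 1 ≤ l → ∀ u : ℝ, μ.real {x | s x ≤ l ^ 2 * u} ≤ D * l ^ k * μ.real {x | s x ≤ u})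
    {ν : ℝ} (hν0 : 0 < ν) (hν1 : ν ≤ 1) {β : ℝ} (hβ : 0 ≤ β) (t : ℝ) :
    Real.sqrt ν ^ k * ∫ x in {x | s x ≤ t}, Real.exp (-(β * s x)) ∂μ
      ≤ D * ∫ x in {x | s x ≤ ν * t}, Real.exp (-(β * s x)) ∂μ := by
  have hsk : 0 < Real.sqrt ν ^ k := pow_pos (Real.sqrt_pos.2 hν0) k
  have hmsW : ∀ u : ℝ, MeasurableSet {x | s x ≤ u} := fun u => measurableSet_le hs measurable_const
  -- the live doubling of the bare window (file 30 §0, BY NAME)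
  have hlive : ∀ u : ℝ, Real.sqrt ν ^ k * μ.real {x | s x ≤ u} ≤ D * μ.real {x | s x ≤ ν * u} := fun u =>
    live_lower_of_doubling (m := fun u => μ.real {x | s x ≤ u}) hdoub hν0 hν1 u
  -- sublevel comparison for the restricted layer cake, weight `e^{−βν s}` on `{s ≤ t}` against `e^{−β s}` on `{s ≤ νt}`
  have hsub : ∀ L : ℝ, μ.real ({x | β * ν * s x ≤ L} ∩ {x | s x ≤ t})
      ≤ D * (Real.sqrt ν ^ k)⁻¹ * μ.real ({x | β * s x ≤ L} ∩ {x | s x ≤ ν * t}) := by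
    intro L
    -- reduce to the live doubling at one level `u`
    have key : ∀ u : ℝ, μ.real {x | s x ≤ u} ≤ D * (Real.sqrt ν ^ k)⁻¹ * μ.real {x | s x ≤ ν * u} := fun u => by
      rw [mul_assoc, mul_comm ((Real.sqrt ν ^ k)⁻¹), ← mul_assoc, ← div_eq_mul_inv, le_div_iff₀ hsk, mul_comm]
      exact hlive u
    rcases hβ.eq_or_lt with hβ0 | hβpos
    · subst hβ0
      by_cases hL : 0 ≤ L
      · have hA : {x : X | 0 * ν * s x ≤ L} ∩ {x | s x ≤ t} = {x | s x ≤ t} := by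
          ext x; simp only [Set.mem_inter_iff, Set.mem_setOf_eq, zero_mul]; exact ⟨fun h => h.2, fun h => ⟨hL, h⟩⟩
        have hB : {x : X | 0 * s x ≤ L} ∩ {x | s x ≤ ν * t} = {x | s x ≤ ν * t} := by
          ext x; simp only [Set.mem_inter_iff, Set.mem_setOf_eq, zero_mul]; exact ⟨fun h => h.2, fun h => ⟨hL, h⟩⟩
        rw [hA, hB]; exact key t
      · have hA : {x : X | 0 * ν * s x ≤ L} ∩ {x | s x ≤ t} = ∅ :=
          Set.eq_empty_of_forall_notMem fun x hx => hL (by simpa using hx.1)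
        have hB : {x : X | 0 * s x ≤ L} ∩ {x | s x ≤ ν * t} = ∅ :=
          Set.eq_empty_of_forall_notMem fun x hx => hL (by simpa using hx.1)
        rw [hA, hB, measureReal_empty, mul_zero]
    · have hβν : 0 < β * ν := mul_pos hβpos hν0
      have hA : {x : X | β * ν * s x ≤ L} ∩ {x | s x ≤ t} = {x | s x ≤ min t (L / (β * ν))} := by
        ext x; simp only [Set.mem_inter_iff, Set.mem_setOf_eq, le_min_iff, le_div_iff₀ hβν]
        constructor
        · rintro ⟨h1, h2⟩; exact ⟨h2, by linarith⟩
        · rintro ⟨h1, h2⟩; exact ⟨by linarith, h1⟩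
      have hB : {x : X | β * s x ≤ L} ∩ {x | s x ≤ ν * t} = {x | s x ≤ ν * min t (L / (β * ν))} := by
        ext x; simp only [Set.mem_inter_iff, Set.mem_setOf_eq]
        have hmin : ν * min t (L / (β * ν)) = min (ν * t) (L / β) := by
          rw [mul_min_of_nonneg _ _ hν0.le]
          congr 1
          field_simp
        rw [hmin, le_min_iff, le_div_iff₀ hβpos]
        constructor
        · rintro ⟨h1, h2⟩; exact ⟨h2, by linarith⟩
        · rintro ⟨h1, h2⟩; exact ⟨by linarith, h1⟩
      rw [hA, hB]; exact key _
  -- §0 with `a = βν`, `b = β`, `K = D(√ν)^{−k}`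
  have hK : 0 ≤ D * (Real.sqrt ν ^ k)⁻¹ := mul_nonneg hD (inv_nonneg.2 hsk.le)
  have hgen := setIntegral_exp_neg_mul_le_of_sublevel μ hs hs0 hβ hK hsub
  -- `e^{−β s} ≤ e^{−βν s}` on the window (`ν ≤ 1`, `s ≥ 0`, `β ≥ 0`)
  have hmeas : ∀ c : ℝ, Measurable fun x => Real.exp (-(c * s x)) := fun c => (Real.measurable_exp.comp ((hs.const_mul c).neg))
  have hint : ∀ c : ℝ, 0 ≤ c → IntegrableOn (fun x => Real.exp (-(c * s x))) {x | s x ≤ t} μ := fun c hc =>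
    (Integrable.of_bound (μ := μ) (hmeas c).aestronglyMeasurable 1 (ae_of_all _ fun x => by
      rw [Real.norm_eq_abs, abs_of_pos (Real.exp_pos _), Real.exp_le_one_iff]; nlinarith [hs0 x])).integrableOn
  have hmono : ∫ x in {x | s x ≤ t}, Real.exp (-(β * s x)) ∂μ ≤ ∫ x in {x | s x ≤ t}, Real.exp (-(β * ν * s x)) ∂μ :=
    setIntegral_mono_on (hint β hβ) (hint (β * ν) (mul_nonneg hβ hν0.le)) (hmsW t) fun x _ => by
      apply Real.exp_le_exp.2
      have : β * ν * s x ≤ β * s x := by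
        have h1 : β * ν ≤ β := mul_le_of_le_one_right hβ hν1
        exact mul_le_mul_of_nonneg_right h1 (hs0 x)
      linarith
  calc Real.sqrt ν ^ k * ∫ x in {x | s x ≤ t}, Real.exp (-(β * s x)) ∂μ
      ≤ Real.sqrt ν ^ k * (D * (Real.sqrt ν ^ k)⁻¹ * ∫ x in {x | s x ≤ ν * t}, Real.exp (-(β * s x)) ∂μ) :=
        mul_le_mul_of_nonneg_left (hmono.trans hgen) hsk.le
    _ = D * (Real.sqrt ν ^ k * (Real.sqrt ν ^ k)⁻¹) * ∫ x in {x | s x ≤ ν * t}, Real.exp (-(β * s x)) ∂μ := by ring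
    _ = D * ∫ x in {x | s x ≤ ν * t}, Real.exp (-(β * s x)) ∂μ := by rw [mul_inv_cancel₀ hsk.ne', mul_one]

end LayerCake

/-! ## §2 `SU(N)` (V38's constant) and `SU(2)` SHARP (V40c): the restricted one-plaquette partition function at a live window -/

section SUN

variable {N : ℕ}

/-- **ALL `N`**: there is `D ≥ 1` (V38's doubling constant) with
`(√ν)^{N²−1}·∫_{Re tr(1−V) ≤ t} e^{−β·Re tr(1−V)} dHaar ≤ D·∫_{Re tr(1−V) ≤ νt} e^{−β·Re tr(1−V)} dHaar` for ALL `β ≥ 0`, `0 < ν ≤ 1`, real `t`. [folklore] -/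
theorem exists_windowedBoltzmann_live_ge : ∃ D : ℝ, 1 ≤ D ∧ ∀ β : ℝ, 0 ≤ β → ∀ ν : ℝ, 0 < ν → ν ≤ 1 → ∀ t : ℝ,
    Real.sqrt ν ^ (N ^ 2 - 1) *
        ∫ V in {V : Matrix.specialUnitaryGroup (Fin N) ℂ | (Matrix.trace (1 - (V : Matrix (Fin N) (Fin N) ℂ))).re ≤ t},
          Real.exp (-(β * (Matrix.trace (1 - (V : Matrix (Fin N) (Fin N) ℂ))).re)) ∂(haarProbability (Matrix.specialUnitaryGroup (Fin N) ℂ))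
      ≤ D * ∫ V in {V : Matrix.specialUnitaryGroup (Fin N) ℂ | (Matrix.trace (1 - (V : Matrix (Fin N) (Fin N) ℂ))).re ≤ ν * t},
          Real.exp (-(β * (Matrix.trace (1 - (V : Matrix (Fin N) (Fin N) ℂ))).re)) ∂(haarProbability (Matrix.specialUnitaryGroup (Fin N) ℂ)) := by
  obtain ⟨D, hD, h⟩ := exists_haarReal_traceWindow_doubling (N := N)
  exact ⟨D, hD, fun β hβ ν hν0 hν1 t => setIntegral_window_live_ge (haarProbability (Matrix.specialUnitaryGroup (Fin N) ℂ))
    measurable_re_trace_one_sub (fun V => by rw [re_trace_one_sub (Matrix.mem_specialUnitaryGroup_iff.1 V.2).1]; positivity) (by linarith) h hν0 hν1 hβ t⟩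

end SUN

section SU2

/-- **`SU(2)` SHARP: THE RESTRICTED ONE-PLAQUETTE PARTITION FUNCTION DOUBLES LIKE THE WINDOW**, constant `1`:
`(√ν)³·z_β(t) ≤ z_β(νt)`, `z_β(u) = ∫_{Re tr(1−V) ≤ u} e^{−β·Re tr(1−V)} dHaar_{SU(2)}`, for ALL `β ≥ 0`, `0 < ν ≤ 1`, real `t`. [folklore] -/
theorem windowedBoltzmann_live_ge_sharp {β ν : ℝ} (hβ : 0 ≤ β) (hν0 : 0 < ν) (hν1 : ν ≤ 1) (t : ℝ) :
    Real.sqrt ν ^ 3 *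
        ∫ V in {V : Matrix.specialUnitaryGroup (Fin 2) ℂ | (Matrix.trace (1 - (V : Matrix (Fin 2) (Fin 2) ℂ))).re ≤ t},
          Real.exp (-(β * (Matrix.trace (1 - (V : Matrix (Fin 2) (Fin 2) ℂ))).re)) ∂(haarProbability (Matrix.specialUnitaryGroup (Fin 2) ℂ))
      ≤ ∫ V in {V : Matrix.specialUnitaryGroup (Fin 2) ℂ | (Matrix.trace (1 - (V : Matrix (Fin 2) (Fin 2) ℂ))).re ≤ ν * t},
          Real.exp (-(β * (Matrix.trace (1 - (V : Matrix (Fin 2) (Fin 2) ℂ))).re)) ∂(haarProbability (Matrix.specialUnitaryGroup (Fin 2) ℂ)) := by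
  have h := setIntegral_window_live_ge (haarProbability (Matrix.specialUnitaryGroup (Fin 2) ℂ)) (D := 1) (k := 3)
    measurable_re_trace_one_sub (fun V => by rw [re_trace_one_sub (Matrix.mem_specialUnitaryGroup_iff.1 V.2).1]; positivity) zero_le_one
    (fun l hl u => by rw [one_mul]; exact haarReal_traceWindow_doubling_one hl u) hν0 hν1 hβ t
  rwa [one_mul] at h

/-- **POSITIVITY**: `e^{−βt}·Haar(W_t) ≤ z_β(t)`, hence `z_β(t) > 0` whenever `Haar(W_t) > 0` (`β ≥ 0`). [folklore] -/
theorem windowedBoltzmann_ge {β : ℝ} (hβ : 0 ≤ β) (t : ℝ) :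
    Real.exp (-(β * t)) * (haarProbability (Matrix.specialUnitaryGroup (Fin 2) ℂ)).real
        {V : Matrix.specialUnitaryGroup (Fin 2) ℂ | (Matrix.trace (1 - (V : Matrix (Fin 2) (Fin 2) ℂ))).re ≤ t}
      ≤ ∫ V in {V : Matrix.specialUnitaryGroup (Fin 2) ℂ | (Matrix.trace (1 - (V : Matrix (Fin 2) (Fin 2) ℂ))).re ≤ t},
          Real.exp (-(β * (Matrix.trace (1 - (V : Matrix (Fin 2) (Fin 2) ℂ))).re)) ∂(haarProbability (Matrix.specialUnitaryGroup (Fin 2) ℂ)) := by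
  have hmeas : Measurable fun V : Matrix.specialUnitaryGroup (Fin 2) ℂ => Real.exp (-(β * (Matrix.trace (1 - (V : Matrix (Fin 2) (Fin 2) ℂ))).re)) :=
    Real.measurable_exp.comp ((measurable_re_trace_one_sub.const_mul β).neg)
  have hint : IntegrableOn (fun V : Matrix.specialUnitaryGroup (Fin 2) ℂ => Real.exp (-(β * (Matrix.trace (1 - (V : Matrix (Fin 2) (Fin 2) ℂ))).re)))
      {V : Matrix.specialUnitaryGroup (Fin 2) ℂ | (Matrix.trace (1 - (V : Matrix (Fin 2) (Fin 2) ℂ))).re ≤ t}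
      (haarProbability (Matrix.specialUnitaryGroup (Fin 2) ℂ)) :=
    (Integrable.of_bound hmeas.aestronglyMeasurable 1 (ae_of_all _ fun V => by
      rw [Real.norm_eq_abs, abs_of_pos (Real.exp_pos _), Real.exp_le_one_iff]
      have h0 : 0 ≤ (Matrix.trace (1 - (V : Matrix (Fin 2) (Fin 2) ℂ))).re := by
        rw [re_trace_one_sub (Matrix.mem_specialUnitaryGroup_iff.1 V.2).1]; positivity
      nlinarith)).integrableOn
  have h1 : Real.exp (-(β * t)) * (haarProbability (Matrix.specialUnitaryGroup (Fin 2) ℂ)).real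
        {V : Matrix.specialUnitaryGroup (Fin 2) ℂ | (Matrix.trace (1 - (V : Matrix (Fin 2) (Fin 2) ℂ))).re ≤ t}
      = ∫ _ in {V : Matrix.specialUnitaryGroup (Fin 2) ℂ | (Matrix.trace (1 - (V : Matrix (Fin 2) (Fin 2) ℂ))).re ≤ t},
          Real.exp (-(β * t)) ∂(haarProbability (Matrix.specialUnitaryGroup (Fin 2) ℂ)) := by
    rw [setIntegral_const, smul_eq_mul]; exact mul_comm _ _
  rw [h1]
  exact setIntegral_mono_on (integrableOn_const (measure_ne_top _ _)) hint (measurableSet_traceWindow t) fun V hV => by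
    apply Real.exp_le_exp.2
    have : β * (Matrix.trace (1 - (V : Matrix (Fin 2) (Fin 2) ℂ))).re ≤ β * t := mul_le_mul_of_nonneg_left hV hβ
    linarith

/-- **THE UNLOWERED LETTER VERBATIM PLUS `(3∕2)·log ν⁻¹`, β-UNIFORMLY**: for `β ≥ 0`, `0 < ν ≤ 1` and a window of positive Haar volume,
`z_β(νt) > 0` and `−log z_β(νt) ≤ −log z_β(t) + (3∕2)·log ν⁻¹`. [folklore] -/
theorem neg_log_windowedBoltzmann_live_le_sharp {β ν t : ℝ} (hβ : 0 ≤ β) (hν0 : 0 < ν) (hν1 : ν ≤ 1)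
    (ht : 0 < (haarProbability (Matrix.specialUnitaryGroup (Fin 2) ℂ)).real
        {V : Matrix.specialUnitaryGroup (Fin 2) ℂ | (Matrix.trace (1 - (V : Matrix (Fin 2) (Fin 2) ℂ))).re ≤ t}) :
    0 < ∫ V in {V : Matrix.specialUnitaryGroup (Fin 2) ℂ | (Matrix.trace (1 - (V : Matrix (Fin 2) (Fin 2) ℂ))).re ≤ ν * t},
          Real.exp (-(β * (Matrix.trace (1 - (V : Matrix (Fin 2) (Fin 2) ℂ))).re)) ∂(haarProbability (Matrix.specialUnitaryGroup (Fin 2) ℂ)) ∧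
    -Real.log (∫ V in {V : Matrix.specialUnitaryGroup (Fin 2) ℂ | (Matrix.trace (1 - (V : Matrix (Fin 2) (Fin 2) ℂ))).re ≤ ν * t},
          Real.exp (-(β * (Matrix.trace (1 - (V : Matrix (Fin 2) (Fin 2) ℂ))).re)) ∂(haarProbability (Matrix.specialUnitaryGroup (Fin 2) ℂ)))
      ≤ -Real.log (∫ V in {V : Matrix.specialUnitaryGroup (Fin 2) ℂ | (Matrix.trace (1 - (V : Matrix (Fin 2) (Fin 2) ℂ))).re ≤ t},
          Real.exp (-(β * (Matrix.trace (1 - (V : Matrix (Fin 2) (Fin 2) ℂ))).re)) ∂(haarProbability (Matrix.specialUnitaryGroup (Fin 2) ℂ)))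
        + 3 / 2 * Real.log ν⁻¹ := by
  have hz : 0 < ∫ V in {V : Matrix.specialUnitaryGroup (Fin 2) ℂ | (Matrix.trace (1 - (V : Matrix (Fin 2) (Fin 2) ℂ))).re ≤ t},
      Real.exp (-(β * (Matrix.trace (1 - (V : Matrix (Fin 2) (Fin 2) ℂ))).re)) ∂(haarProbability (Matrix.specialUnitaryGroup (Fin 2) ℂ)) :=
    lt_of_lt_of_le (mul_pos (Real.exp_pos _) ht) (windowedBoltzmann_ge hβ t)
  have h := windowedBoltzmann_live_ge_sharp hβ hν0 hν1 t
  have hsk : 0 < Real.sqrt ν ^ 3 := pow_pos (Real.sqrt_pos.2 hν0) 3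
  have hL : 0 < Real.sqrt ν ^ 3 * _ := mul_pos hsk hz
  have hpos := hL.trans_le h
  refine ⟨hpos, ?_⟩
  have hlog := Real.log_le_log hL h
  rw [Real.log_mul hsk.ne' hz.ne', Real.log_pow, Real.log_sqrt hν0.le] at hlog
  have e1 : ((3 : ℕ) : ℝ) * (Real.log ν / 2) = 3 * Real.log ν / 2 := by norm_num; ring
  have e2 : (3 : ℝ) / 2 * Real.log ν⁻¹ = -(3 * Real.log ν / 2) := by rw [Real.log_inv]; ring
  rw [e1] at hlog; rw [e2]; linarith

/-- **THE LETTER TRANSFER, β-UNIFORM AND CLAUSE-FREE**: ANY valid letter `−log z_β(t) ≤ L` for the restricted one-plaquette partition function at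
a window of positive Haar volume reads `−log z_β(νt) ≤ L + (3∕2)·log ν₀⁻¹` for every `ν ∈ [ν₀, 1]`, `ν₀ > 0`, and every `β ≥ 0`. [folklore] -/
theorem letter_windowedBoltzmann_live_sharp {β ν ν₀ t L : ℝ} (hβ : 0 ≤ β) (hν₀ : 0 < ν₀) (hν : ν₀ ≤ ν) (hν1 : ν ≤ 1)
    (ht : 0 < (haarProbability (Matrix.specialUnitaryGroup (Fin 2) ℂ)).real
        {V : Matrix.specialUnitaryGroup (Fin 2) ℂ | (Matrix.trace (1 - (V : Matrix (Fin 2) (Fin 2) ℂ))).re ≤ t})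
    (hL : -Real.log (∫ V in {V : Matrix.specialUnitaryGroup (Fin 2) ℂ | (Matrix.trace (1 - (V : Matrix (Fin 2) (Fin 2) ℂ))).re ≤ t},
          Real.exp (-(β * (Matrix.trace (1 - (V : Matrix (Fin 2) (Fin 2) ℂ))).re)) ∂(haarProbability (Matrix.specialUnitaryGroup (Fin 2) ℂ))) ≤ L) :
    -Real.log (∫ V in {V : Matrix.specialUnitaryGroup (Fin 2) ℂ | (Matrix.trace (1 - (V : Matrix (Fin 2) (Fin 2) ℂ))).re ≤ ν * t},
          Real.exp (-(β * (Matrix.trace (1 - (V : Matrix (Fin 2) (Fin 2) ℂ))).re)) ∂(haarProbability (Matrix.specialUnitaryGroup (Fin 2) ℂ)))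
      ≤ L + 3 / 2 * Real.log ν₀⁻¹ := by
  obtain ⟨-, h⟩ := neg_log_windowedBoltzmann_live_le_sharp hβ (hν₀.trans_le hν) hν1 ht
  linarith [half_mul_log_inv_le (k := (3 : ℝ)) (by norm_num) hν₀ hν]

end SU2

/-! ## §3 The REGION: product Haar on `B → SU(2)`, `S = Σ_b Re tr(1 − v_b)`, window `Π_b W` -/

section Region

variable {B : Type*} [Fintype B]

/-- **A REGION AT A LIVE WINDOW, SHARP, β-UNIFORM**: `(√ν)^{3·#B}·∫_{Π W_t} e^{−βS} dκ ≤ ∫_{Π W_{νt}} e^{−βS} dκ` (`β ≥ 0`, `0 < ν ≤ 1`). [folklore] -/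
theorem windowedBoltzmann_pi_live_ge_sharp {β ν : ℝ} (hβ : 0 ≤ β) (hν0 : 0 < ν) (hν1 : ν ≤ 1) (t : ℝ) :
    (Real.sqrt ν ^ 3) ^ Fintype.card B *
      ∫ v in Set.univ.pi fun _ : B => {V : Matrix.specialUnitaryGroup (Fin 2) ℂ | (Matrix.trace (1 - (V : Matrix (Fin 2) (Fin 2) ℂ))).re ≤ t},
        Real.exp (-(β * ∑ b, (Matrix.trace (1 - ((v b : Matrix.specialUnitaryGroup (Fin 2) ℂ) : Matrix (Fin 2) (Fin 2) ℂ))).re))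
        ∂(Measure.pi fun _ : B => haarProbability (Matrix.specialUnitaryGroup (Fin 2) ℂ))
      ≤ ∫ v in Set.univ.pi fun _ : B => {V : Matrix.specialUnitaryGroup (Fin 2) ℂ | (Matrix.trace (1 - (V : Matrix (Fin 2) (Fin 2) ℂ))).re ≤ ν * t},
        Real.exp (-(β * ∑ b, (Matrix.trace (1 - ((v b : Matrix.specialUnitaryGroup (Fin 2) ℂ) : Matrix (Fin 2) (Fin 2) ℂ))).re))
        ∂(Measure.pi fun _ : B => haarProbability (Matrix.specialUnitaryGroup (Fin 2) ℂ)) := by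
  rw [setIntegral_pi_window_eq_pow, setIntegral_pi_window_eq_pow, ← mul_pow]
  have h0 : 0 ≤ Real.sqrt ν ^ 3 * ∫ V in {V : Matrix.specialUnitaryGroup (Fin 2) ℂ | (Matrix.trace (1 - (V : Matrix (Fin 2) (Fin 2) ℂ))).re ≤ t},
      Real.exp (-(β * (Matrix.trace (1 - (V : Matrix (Fin 2) (Fin 2) ℂ))).re)) ∂(haarProbability (Matrix.specialUnitaryGroup (Fin 2) ℂ)) :=
    mul_nonneg (pow_nonneg (Real.sqrt_nonneg _) _) (setIntegral_nonneg (measurableSet_traceWindow t) fun V _ => (Real.exp_pos _).le)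
  exact pow_le_pow_left₀ h0 (windowedBoltzmann_live_ge_sharp hβ hν0 hν1 t) _

/-- **THE REGION's LOG FORM ON THE GRID**: for `β ≥ 0`, `ν₀ > 0`, `ν ∈ [ν₀, 1]`, every bond set `B` and every window of positive Haar volume,
`−log ∫_{Π W_{νt}} e^{−βS} dκ ≤ −log ∫_{Π W_t} e^{−βS} dκ + #B·(3∕2)·log ν₀⁻¹` — β-uniform, clause-free, ONE summand for the grid. [folklore] -/
theorem neg_log_windowedBoltzmann_pi_live_le_sharp {β ν ν₀ t : ℝ} (hβ : 0 ≤ β) (hν₀ : 0 < ν₀) (hν : ν₀ ≤ ν) (hν1 : ν ≤ 1)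
    (ht : 0 < (haarProbability (Matrix.specialUnitaryGroup (Fin 2) ℂ)).real
        {V : Matrix.specialUnitaryGroup (Fin 2) ℂ | (Matrix.trace (1 - (V : Matrix (Fin 2) (Fin 2) ℂ))).re ≤ t}) :
    -Real.log (∫ v in Set.univ.pi fun _ : B => {V : Matrix.specialUnitaryGroup (Fin 2) ℂ | (Matrix.trace (1 - (V : Matrix (Fin 2) (Fin 2) ℂ))).re ≤ ν * t},
        Real.exp (-(β * ∑ b, (Matrix.trace (1 - ((v b : Matrix.specialUnitaryGroup (Fin 2) ℂ) : Matrix (Fin 2) (Fin 2) ℂ))).re))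
        ∂(Measure.pi fun _ : B => haarProbability (Matrix.specialUnitaryGroup (Fin 2) ℂ)))
      ≤ -Real.log (∫ v in Set.univ.pi fun _ : B => {V : Matrix.specialUnitaryGroup (Fin 2) ℂ | (Matrix.trace (1 - (V : Matrix (Fin 2) (Fin 2) ℂ))).re ≤ t},
        Real.exp (-(β * ∑ b, (Matrix.trace (1 - ((v b : Matrix.specialUnitaryGroup (Fin 2) ℂ) : Matrix (Fin 2) (Fin 2) ℂ))).re))
        ∂(Measure.pi fun _ : B => haarProbability (Matrix.specialUnitaryGroup (Fin 2) ℂ)))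
        + (Fintype.card B : ℝ) * (3 / 2 * Real.log ν₀⁻¹) := by
  have hle := letter_windowedBoltzmann_live_sharp hβ hν₀ hν hν1 ht le_rfl
  rw [setIntegral_pi_window_eq_pow, setIntegral_pi_window_eq_pow, Real.log_pow, Real.log_pow]
  have hn : (0 : ℝ) ≤ Fintype.card B := Nat.cast_nonneg _
  have := mul_le_mul_of_nonneg_left hle hn
  linarith

end Region

/-! ## §4 Sanity: `β = 0` is the bare window doubling of file 30 -/

/-- At `β = 0` the windowed Boltzmann weight is the window volume and §2 is file 30's `live_traceWindow_ge_sharp`. -/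
example {ν : ℝ} (hν0 : 0 < ν) (hν1 : ν ≤ 1) (t : ℝ) :
    Real.sqrt ν ^ 3 *
        ∫ V in {V : Matrix.specialUnitaryGroup (Fin 2) ℂ | (Matrix.trace (1 - (V : Matrix (Fin 2) (Fin 2) ℂ))).re ≤ t},
          Real.exp (-(0 * (Matrix.trace (1 - (V : Matrix (Fin 2) (Fin 2) ℂ))).re)) ∂(haarProbability (Matrix.specialUnitaryGroup (Fin 2) ℂ))
      ≤ ∫ V in {V : Matrix.specialUnitaryGroup (Fin 2) ℂ | (Matrix.trace (1 - (V : Matrix (Fin 2) (Fin 2) ℂ))).re ≤ ν * t},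
          Real.exp (-(0 * (Matrix.trace (1 - (V : Matrix (Fin 2) (Fin 2) ℂ))).re)) ∂(haarProbability (Matrix.specialUnitaryGroup (Fin 2) ℂ)) :=
  windowedBoltzmann_live_ge_sharp le_rfl hν0 hν1 t

end Summit.QuantumFields.BalabanUV.T4Continuum.Spine.NE7c.LiveFactorWindowBoltzmann

end
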